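import Summits.CriticalPhenomena.PercolationContinuityZ3.Theorems.Transplant.K4MinorFreePaths
import HarnessLib

/-!
# `K₄`-minor-free graphs are partial 2-trees — file 3: Dirac's lemma, suppression of degree-two vertices, the 2-tree embedding

Support file (`--supports stmt-CriticalPhenomena-4575`), FK sub-lane `prim-bschramm-fk-3` (gen 6) of the post-continuity
programme; builds on p205010 (kernel theorem, internal audit signed; external expert review pending).  Pure graph theory, no
named facts, no sorries; standard axioms.  PURPOSE: the discharge of the named fact `Wagner2008_rc_edgeNegCorr_of_noK4Minor`
(Wagner 2008, graph case; `Literature/Probability/LatticeModels/RandomClusterRayleighSeriesParallel.lean`) needs the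
classical STRUCTURE THEOREM "a finite graph without a `K₄` minor is a subgraph of a 2-tree" (Dirac 1952 / Duffin 1965 /
Wald–Colbourn 1983; Diestel, Graph Theory, §7.3), so that fk-1's kernel theorem `FK.rc_edgeNegCorr_of_isTwoTree` (negative edge correlation of
`φ_{w,q}`, `0 < q ≤ 1`, on 2-tree supports) applies to every `K₄`-minor-free support.

This file (proofs only):
* `K4Free.hasK4Minor_of_isLongest` / `K4Free.hasK4Minor_of_threeNeighbours` — DIRAC'S LEMMA in minor form: a finite graph with
  an edge in which every non-isolated vertex has three neighbours has a `K₄` minor.  Proof by the ROTATION DESCENT: take a longest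
  path `f`; its first vertex has chords `f 0 ~ f i`, `f 0 ~ f j` (`2 ≤ i < j`); rotate at `i`; a neighbour `f k` (`k > i`) of the new
  first vertex `f (i-1)` gives crossing chords or a long jump (file 2), otherwise all its neighbours have index `≤ i < j` and
  strong induction on that bound concludes.  (Branch sets are path segments throughout — no Menger, no block decomposition.)
* `K4Free.exists_le_two_neighbours` — hence a `K₄`-minor-free graph with an edge has a vertex with one or two neighbours;
* `K4Free.hasK4Minor_of_suppress` — a `K₄` minor of `(G − v) + uw` (`v ~ u`, `v ~ w`) lifts to `G`;
* `K4Free.exists_superset_of_not_hasK4Minor` — for ANY property `P` of pair sets containing the single pairs and closed under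
  gluing a fresh vertex onto a member pair (e.g. fk-1's `FK.IsTwoTree`), every `K₄`-minor-free graph with edges inside a vertex
  set `s`, `|s| ≥ 2`, lies inside some `T` with `P T` on the vertices of `s` (induction on `|s|`).
[cite: Diestel2017, §7.3 (Prop. 7.3.1, Cor. 7.3.2); §1.7] [cite: Wagner2006, §5.3]
-/

namespace Summit.CriticalPhenomena.PercolationContinuityZ3.Theorems

namespace K4Free

open Literature.Probability.LatticeModels (HasK4Minor)

variable {V : Type*} {G : SimpleGraph V}

/-! ### Dirac's lemma: three neighbours at every non-isolated vertex force a `K₄` minor -/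

/-- Under `ThreeNeighbours`, the first vertex of a longest path (of length `≥ 1`) has two neighbours `f i`, `f j` on the
path with `2 ≤ i < j ≤ m`. [folklore] -/
theorem IsLongest.exists_two_chords {f : ℕ → V} {m : ℕ} (h : IsLongest G f m) (h3 : ThreeNeighbours G)
    (hm : 1 ≤ m) : ∃ i j, 2 ≤ i ∧ i < j ∧ j ≤ m ∧ G.Adj (f 0) (f i) ∧ G.Adj (f 0) (f j) := by
  obtain ⟨a, b, c, ha, hb, hc, hab, hac, hbc⟩ := h3 (f 0) ⟨f 1, h.1.adj 0 (by omega)⟩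
  obtain ⟨ta, ta1, tam, rfl⟩ := h.exists_eq_of_adj ha
  obtain ⟨tb, tb1, tbm, rfl⟩ := h.exists_eq_of_adj hb
  obtain ⟨tc, tc1, tcm, rfl⟩ := h.exists_eq_of_adj hc
  have hab' : ta ≠ tb := fun h' => hab (by rw [h'])
  have hac' : ta ≠ tc := fun h' => hac (by rw [h'])
  have hbc' : tb ≠ tc := fun h' => hbc (by rw [h'])
  -- among three distinct indices `≥ 1`, two are `≥ 2`; order them
  by_cases hta : ta = 1
  · rcases lt_or_gt_of_ne hbc' with hlt | hlt
    · exact ⟨tb, tc, by omega, hlt, tcm, hb, hc⟩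
    · exact ⟨tc, tb, by omega, hlt, tbm, hc, hb⟩
  · by_cases htb : tb = 1
    · rcases lt_or_gt_of_ne hac' with hlt | hlt
      · exact ⟨ta, tc, by omega, hlt, tcm, ha, hc⟩
      · exact ⟨tc, ta, by omega, hlt, tam, hc, ha⟩
    · rcases lt_or_gt_of_ne hab' with hlt | hlt
      · exact ⟨ta, tb, by omega, hlt, tbm, ha, hb⟩
      · exact ⟨tb, ta, by omega, hlt, tam, hb, ha⟩

/-- **The rotation descent.**  Under `ThreeNeighbours`, a longest path `f` of length `m ≥ 1` all of whose first-vertex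
neighbours have index `≤ J` yields a `K₄` minor — by strong induction on `J`: with chords `f 0 ~ f i`, `f 0 ~ f j`
(`2 ≤ i < j`), rotate at `i`; a neighbour `f k` of the new first vertex `f (i-1)` with `k > i` gives crossing chords (`k ≤ j`)
or a long jump (`k > j`), and otherwise the rotated path has all first-vertex neighbours at indices `≤ i < J`.
[cite: Diestel2017, §7.3 (Hadwiger's conjecture for r = 4: graphs of minimum degree 3 contain K⁴ minors)] -/
theorem hasK4Minor_of_isLongest (h3 : ThreeNeighbours G) {m : ℕ} (hm : 1 ≤ m) :
    ∀ (J : ℕ) (f : ℕ → V), IsLongest G f m → (∀ t, t ≤ m → G.Adj (f 0) (f t) → t ≤ J) → HasK4Minor G := by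
  intro J
  induction J using Nat.strong_induction_on with
  | _ J ih =>
    intro f hf hJ
    obtain ⟨i, j, hi2, hij, hjm, h0i, h0j⟩ := hf.exists_two_chords h3 hm
    have hjJ : j ≤ J := hJ j hjm h0j
    -- the rotated path
    have hg : IsLongest G (rot f i) m := hf.rot hi2 (by omega) h0i
    by_cases hfar : ∃ t, i < t ∧ t ≤ m ∧ G.Adj (rot f i 0) (rot f i t)
    · obtain ⟨k, hik, hkm, hk⟩ := hfar
      rw [rot_zero (by omega), rot_of_le hik.le] at hk
      by_cases hkj : k ≤ j
      · exact hf.1.hasK4Minor_A1 hi2 hik hkj hjm h0i h0j hk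
      · exact hf.1.hasK4Minor_A2 hi2 hij (by omega) hkm h0i h0j hk
    · refine ih i (by omega) (rot f i) hg fun t htm ht => ?_
      by_contra hti
      exact hfar ⟨t, by omega, htm, ht⟩

/-- **Dirac's lemma (minor form)**: a finite graph with an edge in which every non-isolated vertex has at least three
neighbours has a `K₄` minor. [cite: Diestel2017, §7.3, Prop. 7.3.1 and Cor. 7.3.2] -/
theorem hasK4Minor_of_threeNeighbours [Fintype V] (h3 : ThreeNeighbours G) {v w : V} (hvw : G.Adj v w) :
    HasK4Minor G := by
  obtain ⟨f, m, hf⟩ := exists_isLongest (G := G) v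
  exact hasK4Minor_of_isLongest h3 (hf.one_le hvw) m f hf fun t ht _ => ht

/-- **A `K₄`-minor-free graph with an edge has a vertex with one or two neighbours.** [cite: Diestel2017, Cor. 7.3.2] -/
theorem exists_le_two_neighbours [Fintype V] (hK : ¬ HasK4Minor G) {v₀ w₀ : V} (hvw : G.Adj v₀ w₀) :
    ∃ v u, G.Adj v u ∧ ((∀ w, G.Adj v w → w = u) ∨
      ∃ u', u' ≠ u ∧ G.Adj v u' ∧ ∀ w, G.Adj v w → w = u ∨ w = u') := by
  by_contra hno
  refine hK (hasK4Minor_of_threeNeighbours (fun v ⟨u, hu⟩ => ?_) hvw)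
  by_contra h3
  refine hno ⟨v, u, hu, ?_⟩
  by_cases h1 : ∀ w, G.Adj v w → w = u
  · exact Or.inl h1
  · right
    obtain ⟨u', hu'adj, hu'ne⟩ : ∃ u', G.Adj v u' ∧ u' ≠ u := by
      by_contra hn
      exact h1 fun w hw => by by_contra hwu; exact hn ⟨w, hw, hwu⟩
    refine ⟨u', hu'ne, hu'adj, fun w hw => ?_⟩
    by_contra hw'
    have hwu : w ≠ u := fun h' => hw' (Or.inl h')
    have hwu' : w ≠ u' := fun h' => hw' (Or.inr h')
    exact h3 ⟨u, u', w, hu, hu'adj, hw, hu'ne.symm, hwu.symm, hwu'.symm⟩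

/-! ### Suppressing a vertex of degree two does not create `K₄` minors out of nothing -/

/-- Reachability transfer along a vertex map that sends edges to reachable pairs. [folklore] -/
theorem reachable_map_of_adj {W W' : Type*} {H : SimpleGraph W} {H' : SimpleGraph W'} (φ : W → W')
    (hφ : ∀ a b, H.Adj a b → H'.Reachable (φ a) (φ b)) {a b : W} (h : H.Reachable a b) :
    H'.Reachable (φ a) (φ b) := by
  obtain ⟨p⟩ := h
  induction p with
  | nil => exact SimpleGraph.Reachable.refl _
  | cons hab _ ih => exact (hφ _ _ hab).trans ih

/-- In `delVert G v ⊔ edge u w` the vertex `v` is isolated (when `v ≠ u`, `v ≠ w`). [folklore] -/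
theorem not_adj_suppress {G : SimpleGraph V} {v u w : V} (hvu : v ≠ u) (hvw : v ≠ w) (b : V) :
    ¬ (delVert G v ⊔ SimpleGraph.edge u w).Adj v b := by
  rintro (h | h)
  · exact h.2.1 rfl
  · rw [SimpleGraph.edge_adj] at h
    rcases h.1 with ⟨h1, -⟩ | ⟨h1, -⟩
    · exact hvu h1
    · exact hvw h1

/-- **Lifting a `K₄` minor through the suppression of a degree-two vertex**: if `v ~ u`, `v ~ w` in `G` and the graph
obtained by deleting the edges at `v` and joining `u – w` has a `K₄` minor, then so has `G` (put `v` into the branch set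
of `u`; the new edge `u – w` is replaced by the path `u – v – w`). [cite: Diestel2017, §1.7 (minors; contracting an edge)] -/
theorem hasK4Minor_of_suppress {G : SimpleGraph V} {v u w : V} (hvu : G.Adj v u) (hvw : G.Adj v w)
    (hK : HasK4Minor (delVert G v ⊔ SimpleGraph.edge u w)) : HasK4Minor G := by
  classical
  set G' := delVert G v ⊔ SimpleGraph.edge u w with hG'
  obtain ⟨B, hne, hconn, hdisj, hadj⟩ := hK
  -- `v` lies in no branch set
  have hvB : ∀ i, v ∉ B i := by
    intro i hv
    -- pick `j ≠ i` and an edge from `B i` to `B j`; walk inside `B i` from `v` to its endpoint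
    obtain ⟨j, hji⟩ : ∃ j : Fin 4, j ≠ i := ⟨i + 1, by
      intro h; have := congrArg Fin.val h; simp [Fin.val_add] at this; omega⟩
    obtain ⟨a, ha, b, hb, hab⟩ := hadj i j hji.symm
    by_cases hav : a = v
    · subst hav; exact not_adj_suppress hvu.ne hvw.ne b hab
    · -- `v` and `a` are distinct vertices of the connected set `B i`: `v` has a `G'`-neighbour
      have hr : (G'.induce (B i)).Reachable ⟨v, hv⟩ ⟨a, ha⟩ := (hconn i) ⟨v, hv⟩ ⟨a, ha⟩
      obtain ⟨p⟩ := hr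
      cases p with
      | nil => exact hav rfl
      | cons h' _ => exact not_adj_suppress hvu.ne hvw.ne _ (SimpleGraph.induce_adj.1 h')
  -- new branch sets
  let B' : Fin 4 → Set V := fun i => if u ∈ B i then insert v (B i) else B i
  have hsub : ∀ i, B i ⊆ B' i := by
    intro i x hx; by_cases hu : u ∈ B i
    · simp only [B', if_pos hu]; exact Set.mem_insert_of_mem _ hx
    · simp only [B', if_neg hu]; exact hx
  have hmem : ∀ i x, x ∈ B' i → x ∈ B i ∨ (x = v ∧ u ∈ B i) := by
    intro i x hx
    by_cases hu : u ∈ B i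
    · simp only [B', if_pos hu, Set.mem_insert_iff] at hx
      rcases hx with rfl | hx
      · exact Or.inr ⟨rfl, hu⟩
      · exact Or.inl hx
    · simp only [B', if_neg hu] at hx; exact Or.inl hx
  have hvB' : ∀ i, u ∈ B i → v ∈ B' i := by
    intro i hu; simp only [B', if_pos hu]; exact Set.mem_insert _ _
  refine ⟨B', fun i => (hne i).mono (hsub i), fun i => ?_, fun i j hij => ?_, fun i j hij => ?_⟩
  · -- connectivity of `B' i` in `G`
    rw [SimpleGraph.connected_iff_exists_forall_reachable]
    obtain ⟨a₀, ha₀⟩ := hne i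
    refine ⟨⟨a₀, hsub i ha₀⟩, ?_⟩
    -- every `G'`-edge inside `B i` becomes a `G`-reachability inside `B' i`
    have hstep : ∀ a b : B i, (G'.induce (B i)).Adj a b →
        (G.induce (B' i)).Reachable ⟨a, hsub i a.2⟩ ⟨b, hsub i b.2⟩ := by
      rintro ⟨a, ha⟩ ⟨b, hb⟩ h'
      rw [SimpleGraph.induce_adj] at h'
      rcases h' with h' | h'
      · exact SimpleGraph.Adj.reachable (SimpleGraph.induce_adj.2 h'.1)
      · rw [SimpleGraph.edge_adj] at h'
        obtain ⟨h', -⟩ := h'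
        -- the edge `u – w`: go through `v`
        have key : ∀ (hu : u ∈ B i) (hw : w ∈ B i),
            (G.induce (B' i)).Reachable ⟨u, hsub i hu⟩ ⟨w, hsub i hw⟩ := by
          intro hu hw
          have hv : v ∈ B' i := hvB' i hu
          have h1 : (G.induce (B' i)).Adj ⟨u, hsub i hu⟩ ⟨v, hv⟩ := SimpleGraph.induce_adj.2 hvu.symm
          have h2 : (G.induce (B' i)).Adj ⟨v, hv⟩ ⟨w, hsub i hw⟩ := SimpleGraph.induce_adj.2 hvw
          exact h1.reachable.trans h2.reachable
        rcases h' with ⟨rfl, rfl⟩ | ⟨rfl, rfl⟩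
        · exact key ha hb
        · exact (key hb ha).symm
    rintro ⟨x, hx⟩
    rcases hmem i x hx with hxB | ⟨rfl, hu⟩
    · exact reachable_map_of_adj (H := G'.induce (B i)) (H' := G.induce (B' i))
        (fun a => ⟨a, hsub i a.2⟩) hstep ((hconn i) ⟨a₀, ha₀⟩ ⟨x, hxB⟩)
    · -- `x = v`: reach `u` first, then step to `v`
      have h1 := reachable_map_of_adj (H := G'.induce (B i)) (H' := G.induce (B' i))
        (fun a => ⟨a, hsub i a.2⟩) hstep ((hconn i) ⟨a₀, ha₀⟩ ⟨u, hu⟩)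
      exact h1.trans (SimpleGraph.Adj.reachable (SimpleGraph.induce_adj.2 (show G.Adj u x from hvu.symm)))
  · -- disjointness
    refine Set.disjoint_left.2 fun x hxi hxj => ?_
    rcases hmem i x hxi with hxi' | ⟨rfl, hui⟩ <;> rcases hmem j x hxj with hxj' | ⟨hxv, huj⟩
    · exact Set.disjoint_left.1 (hdisj i j hij) hxi' hxj'
    · exact hvB i (hxv ▸ hxi')
    · exact hvB j hxj'
    · exact Set.disjoint_left.1 (hdisj i j hij) hui huj
  · -- adjacency between branch sets
    obtain ⟨a, ha, b, hb, hab⟩ := hadj i j hij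
    rcases hab with hab | hab
    · exact ⟨a, hsub i ha, b, hsub j hb, hab.1⟩
    · rw [SimpleGraph.edge_adj] at hab
      rcases hab.1 with ⟨rfl, rfl⟩ | ⟨rfl, rfl⟩
      · exact ⟨v, hvB' i ha, b, hsub j hb, hvw⟩
      · exact ⟨a, hsub i ha, v, hvB' j hb, hvw.symm⟩

/-! ### Every `K₄`-minor-free graph lies inside a 2-tree -/

/-- A nondiagonal pair containing `u` is `s(u, y)` for some `y ≠ u`. [folklore] -/
theorem exists_eq_mk_of_mem {e : Sym2 V} {u : V} (hu : u ∈ e) (hd : ¬ e.IsDiag) : ∃ y, y ≠ u ∧ e = s(u, y) :=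
  ⟨Sym2.Mem.other hu, Sym2.other_ne hd hu, (Sym2.other_spec hu).symm⟩

/-- **`K₄`-minor-free graphs are partial 2-trees** (Dirac 1952 / Duffin 1965 / Wald–Colbourn 1983), in abstract form: let
`P` be any property of sets of pairs containing every single pair `{uv}` (`u ≠ v`) and closed under gluing a fresh vertex `x`
onto a member pair `uv` (`T ↦ T ∪ {ux, xv}`) — e.g. "is a 2-tree".  Then for every finite `K₄`-minor-free graph `G` whose
edges lie inside a vertex set `s` with `|s| ≥ 2` there is a `T` with property `P` containing all edges of `G`, covering
every vertex of `s`, using only vertices of `s`, and consisting of nondiagonal pairs.  Proof: induction on `|s|`, removing a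
vertex with at most two neighbours (`exists_le_two_neighbours`) and suppressing it (`hasK4Minor_of_suppress`).
[cite: Diestel2017, §7.3, Prop. 7.3.1 and Cor. 7.3.2 (structure of the graphs without a K⁴ minor)] -/
theorem exists_superset_of_not_hasK4Minor [Fintype V] [DecidableEq V] (P : Set (Sym2 V) → Prop)
    (hpair : ∀ u v : V, u ≠ v → P {s(u, v)})
    (hcons : ∀ (T : Set (Sym2 V)) (u v x : V), P T → s(u, v) ∈ T → (∀ e ∈ T, x ∉ e) →
      P (T ∪ {s(u, x), s(x, v)})) :
    ∀ (n : ℕ) (s : Finset V) (G : SimpleGraph V), s.card = n + 2 → ¬ HasK4Minor G →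
      (∀ a b, G.Adj a b → a ∈ s ∧ b ∈ s) →
      ∃ T : Set (Sym2 V), P T ∧ (∀ a b, G.Adj a b → s(a, b) ∈ T) ∧ (∀ x ∈ s, ∃ e ∈ T, x ∈ e) ∧
        (∀ e ∈ T, ∀ x ∈ e, x ∈ s) ∧ (∀ e ∈ T, ¬ e.IsDiag) := by
  intro n
  induction n with
  | zero =>
    intro s G hs hK hG
    obtain ⟨a, b, hab, rfl⟩ := Finset.card_eq_two.1 hs
    refine ⟨{s(a, b)}, hpair a b hab, fun x y hxy => ?_, fun x hx => ?_, fun e he x hx => ?_, fun e he => ?_⟩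
    · obtain ⟨hx, hy⟩ := hG x y hxy
      simp only [Finset.mem_insert, Finset.mem_singleton] at hx hy
      have hne := hxy.ne
      rcases hx with rfl | rfl <;> rcases hy with rfl | rfl
      · exact (hne rfl).elim
      · exact Set.mem_singleton _
      · exact Sym2.eq_swap ▸ Set.mem_singleton _
      · exact (hne rfl).elim
    · refine ⟨s(a, b), Set.mem_singleton _, ?_⟩
      simp only [Finset.mem_insert, Finset.mem_singleton] at hx
      rcases hx with rfl | rfl
      · exact Sym2.mem_mk_left _ _
      · exact Sym2.mem_mk_right _ _
    · rw [Set.mem_singleton_iff.1 he] at hx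
      rcases Sym2.mem_iff.1 hx with rfl | rfl <;> simp
    · rw [Set.mem_singleton_iff.1 he, Sym2.mk_isDiag_iff]; exact hab
  | succ n ih =>
    intro s G hs hK hG
    -- common gluing step: from `T'` on `s.erase v` with a member pair `s(u, y)` (`u ≠ y`), glue `v` onto it
    have glue : ∀ (v : V) (_ : v ∈ s) (T' : Set (Sym2 V)) (u y : V), P T' → s(u, y) ∈ T' →
        (∀ x ∈ s.erase v, ∃ e ∈ T', x ∈ e) → (∀ e ∈ T', ∀ x ∈ e, x ∈ s.erase v) → (∀ e ∈ T', ¬ e.IsDiag) →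
        (∀ a b, G.Adj a b → a ≠ v → b ≠ v → s(a, b) ∈ T') → (∀ b, G.Adj v b → b = u ∨ b = y) →
        ∃ T : Set (Sym2 V), P T ∧ (∀ a b, G.Adj a b → s(a, b) ∈ T) ∧ (∀ x ∈ s, ∃ e ∈ T, x ∈ e) ∧
          (∀ e ∈ T, ∀ x ∈ e, x ∈ s) ∧ (∀ e ∈ T, ¬ e.IsDiag) := by
      intro v hv T' u y hP huy hcov hwithin hnd hedges hnbrs
      have hu : u ∈ s.erase v := hwithin _ huy u (Sym2.mem_mk_left _ _)
      have hy : y ∈ s.erase v := hwithin _ huy y (Sym2.mem_mk_right _ _)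
      have huv : u ≠ v := Finset.ne_of_mem_erase hu
      have hyv : y ≠ v := Finset.ne_of_mem_erase hy
      have hfresh : ∀ e ∈ T', v ∉ e := fun e he hve => Finset.ne_of_mem_erase (hwithin e he v hve) rfl
      refine ⟨T' ∪ {s(u, v), s(v, y)}, hcons T' u y v hP huy hfresh, fun a b hab => ?_, fun x hx => ?_,
        fun e he x hx => ?_, fun e he => ?_⟩
      · by_cases hav : a = v
        · subst hav
          rcases hnbrs b hab with rfl | rfl
          · exact Or.inr (Or.inl Sym2.eq_swap)
          · exact Or.inr (Or.inr rfl)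
        · by_cases hbv : b = v
          · subst hbv
            rcases hnbrs a hab.symm with rfl | rfl
            · exact Or.inr (Or.inl rfl)
            · exact Or.inr (Or.inr Sym2.eq_swap)
          · exact Or.inl (hedges a b hab hav hbv)
      · by_cases hxv : x = v
        · subst hxv; exact ⟨s(u, x), Or.inr (Or.inl rfl), Sym2.mem_mk_right _ _⟩
        · obtain ⟨e, he, hxe⟩ := hcov x (Finset.mem_erase.2 ⟨hxv, hx⟩)
          exact ⟨e, Or.inl he, hxe⟩
      · rcases he with he | he | he
        · exact Finset.mem_of_mem_erase (hwithin e he x hx)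
        · rw [he] at hx
          rcases Sym2.mem_iff.1 hx with rfl | rfl
          · exact Finset.mem_of_mem_erase hu
          · exact hv
        · rw [Set.mem_singleton_iff.1 he] at hx
          rcases Sym2.mem_iff.1 hx with rfl | rfl
          · exact hv
          · exact Finset.mem_of_mem_erase hy
      · rcases he with he | he | he
        · exact hnd e he
        · rw [he, Sym2.mk_isDiag_iff]; exact huv
        · rw [Set.mem_singleton_iff.1 he, Sym2.mk_isDiag_iff]; exact hyv.symm
    by_cases hE : ∃ a b, G.Adj a b
    · -- a vertex `v` with one or two neighbours
      obtain ⟨a₀, b₀, hab₀⟩ := hE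
      obtain ⟨v, u, hvu, hdeg⟩ := exists_le_two_neighbours hK hab₀
      have hv : v ∈ s := (hG v u hvu).1
      have hu : u ∈ s := (hG v u hvu).2
      have hcard : (s.erase v).card = n + 2 := by rw [Finset.card_erase_of_mem hv, hs]; rfl
      rcases hdeg with hdeg | ⟨u', hu'u, hvu', hdeg⟩
      · -- one neighbour: delete the edges at `v`
        obtain ⟨T', hP, hedges, hcov, hwithin, hnd⟩ := ih (s.erase v) (delVert G v) hcard
          (fun h => hK (hasK4Minor_of_le (delVert_le G v) h))
          (fun a b hab => ⟨Finset.mem_erase.2 ⟨hab.2.1, (hG a b hab.1).1⟩,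
            Finset.mem_erase.2 ⟨hab.2.2, (hG a b hab.1).2⟩⟩)
        obtain ⟨e, he, hue⟩ := hcov u (Finset.mem_erase.2 ⟨hvu.ne.symm, hu⟩)
        obtain ⟨y, -, rfl⟩ := exists_eq_mk_of_mem hue (hnd e he)
        exact glue v hv T' u y hP he hcov hwithin hnd (fun a b hab hav hbv => hedges a b ⟨hab, hav, hbv⟩)
          fun b hb => Or.inl (hdeg b hb)
      · -- two neighbours `u ≠ u'`: suppress `v`
        obtain ⟨T', hP, hedges, hcov, hwithin, hnd⟩ := ih (s.erase v) (delVert G v ⊔ SimpleGraph.edge u u') hcard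
          (fun h => hK (hasK4Minor_of_suppress hvu hvu' h))
          (fun a b hab => by
            rcases hab with hab | hab
            · exact ⟨Finset.mem_erase.2 ⟨hab.2.1, (hG a b hab.1).1⟩, Finset.mem_erase.2 ⟨hab.2.2, (hG a b hab.1).2⟩⟩
            · rw [SimpleGraph.edge_adj] at hab
              have hu₁ : u ∈ s.erase v := Finset.mem_erase.2 ⟨hvu.ne.symm, hu⟩
              have hu₂ : u' ∈ s.erase v := Finset.mem_erase.2 ⟨hvu'.ne.symm, (hG v u' hvu').2⟩
              rcases hab.1 with ⟨rfl, rfl⟩ | ⟨rfl, rfl⟩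
              · exact ⟨hu₁, hu₂⟩
              · exact ⟨hu₂, hu₁⟩)
        have huu' : s(u, u') ∈ T' :=
          hedges u u' (Or.inr ((SimpleGraph.edge_adj _ _ _ _).2 ⟨Or.inl ⟨rfl, rfl⟩, hu'u.symm⟩))
        exact glue v hv T' u u' hP huu' hcov hwithin hnd
          (fun a b hab hav hbv => hedges a b (Or.inl ⟨hab, hav, hbv⟩)) fun b hb => hdeg b hb
    · -- no edge at all: glue an arbitrary vertex of `s` onto an arbitrary member pair
      have hsne : s.Nonempty := by rw [← Finset.card_pos, hs]; omega
      obtain ⟨v, hv⟩ := hsne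
      have hcard : (s.erase v).card = n + 2 := by rw [Finset.card_erase_of_mem hv, hs]; rfl
      obtain ⟨T', hP, -, hcov, hwithin, hnd⟩ := ih (s.erase v) G hcard hK
        (fun a b hab => (hE ⟨a, b, hab⟩).elim)
      have hne' : (s.erase v).Nonempty := by rw [← Finset.card_pos, hcard]; omega
      obtain ⟨x, hx⟩ := hne'
      obtain ⟨e, he, hxe⟩ := hcov x hx
      obtain ⟨y, -, rfl⟩ := exists_eq_mk_of_mem hxe (hnd e he)
      exact glue v hv T' x y hP he hcov hwithin hnd (fun a b hab => (hE ⟨a, b, hab⟩).elim)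
        fun b hb => (hE ⟨v, b, hb⟩).elim

end K4Free

end Summit.CriticalPhenomena.PercolationContinuityZ3.Theorems
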